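import Literature.Geometry.Lorentzian.ADMTailCoefficientClass
import HarnessLib

/-!
# Late-time gauge reducibility of an ADM coefficient tuple (Ellithy 2026, Definition 3.29)

A. Ellithy, *The spacetime Penrose inequality under a quasi final state hypothesis*,
arXiv:2605.18730 (2026), §3.4, Definition 3.29 (p. 34): "We say that `𝒮` is late-time gauge
reducible if `𝒮 ∈ 𝒞𝒮♯_{-τ}(ℳ)`, and for every `r₁ > r₀`, `𝔅♯(T; r₁) → 0` as `T → ∞`."  Here
`𝔅♯(T; r₁) = sup_{t ≥ T} ‖β^⊥(t, ·)‖_{C^{2+α,1+α/2,♯}_{-τ}(M_{r₁,∞})}` is the geometric normal-shift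
tail of Definition 3.8 (`ADMTailTuple.normalShiftTail`) and `𝒞𝒮♯_{-τ}(ℳ)` the strengthened tail
coefficient space (`ADMTailTuple.IsSharpTailCoeff`), both in `ADMTailCoefficientClass`.
Remark 3.9 (p. 22): "To make this coordinate change [to the good gauge `b = 0`, `β_r = 0`], we will
in addition need `𝔅♯(T; r₁)` to decay as `T` goes to infinity; this will be part of the quasi final
state hypothesis"; Remark 3.30 (p. 34): "The late-time gauge reducibility assumption is the
condition that allows us to pass from the given general ADM chart to the good gauge on late slabs
away from the horizon."

This is part D37′b of the typing of the quasi final state hypothesis (Def. 4.4, bullet 2, first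
clause; file `QuasiFinalAnalytic`). Definitions only; no facts.

## References

* [Ellithy2026] A. Ellithy, arXiv:2605.18730 (2026), Definition 3.29, Remarks 3.9, 3.30, p. 34.
-/

noncomputable section

open Set Filter
open scoped ENNReal Topology

namespace Literature.Geometry.Lorentzian

namespace ADMTailTuple

variable (S : ADMTailTuple)

/-- **The normal-shift tail decays on the fixed tail `r > r₁`**: `𝔅♯(T; r₁) → 0` as `T → ∞` (in
`[0, ∞]`; in particular `𝔅♯(T; r₁)` is eventually finite). [cite: Ellithy2026, Def. 3.29 p. 34] -/
def HasDecayingNormalShift (α τ Tlo r₁ : ℝ) : Prop :=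
  Tendsto (fun T ↦ S.normalShiftTail α τ Tlo r₁ T) atTop (𝓝 0)

/-- **Definition 3.29 — late-time gauge reducibility**: `𝒮 ∈ 𝒞𝒮♯_{-τ}(ℳ)`,
`ℳ = (T̲, ∞) × (r₀, ∞) × S²`, and for every `r₁ > r₀`, `𝔅♯(T; r₁) → 0` as `T → ∞` (Ellithy 2026,
Def. 3.29, p. 34). Hölder exponent `α` and order `τ` as in `IsSharpTailCoeff`.
[cite: Ellithy2026, Def. 3.29 p. 34] -/
def IsGaugeReducible (α τ Tlo r₀ : ℝ) : Prop :=
  S.IsSharpTailCoeff α τ Tlo r₀ ∧ ∀ r₁, r₀ < r₁ → S.HasDecayingNormalShift α τ Tlo r₁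

/-- A gauge reducible tuple lies in `𝒞𝒮♯_{-τ}(ℳ)`. [cite: Ellithy2026, Def. 3.29 p. 34] -/
theorem IsGaugeReducible.isSharpTailCoeff {S : ADMTailTuple} {α τ Tlo r₀ : ℝ}
    (h : S.IsGaugeReducible α τ Tlo r₀) : S.IsSharpTailCoeff α τ Tlo r₀ := h.1

/-- The decay clause of gauge reducibility on a fixed tail. [cite: Ellithy2026, Def. 3.29 p. 34] -/
theorem IsGaugeReducible.tendsto {S : ADMTailTuple} {α τ Tlo r₀ : ℝ}
    (h : S.IsGaugeReducible α τ Tlo r₀) {r₁ : ℝ} (hr : r₀ < r₁) :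
    Tendsto (fun T ↦ S.normalShiftTail α τ Tlo r₁ T) atTop (𝓝 0) := h.2 r₁ hr

/-- Under gauge reducibility the normal-shift tail is eventually finite on every fixed tail (a limit
`0` in `[0, ∞]` is eventually below `1`). [cite: Ellithy2026, Def. 3.29 p. 34] -/
theorem IsGaugeReducible.eventually_lt_top {S : ADMTailTuple} {α τ Tlo r₀ : ℝ}
    (h : S.IsGaugeReducible α τ Tlo r₀) {r₁ : ℝ} (hr : r₀ < r₁) :
    ∀ᶠ T in atTop, S.normalShiftTail α τ Tlo r₁ T < ⊤ := by
  have h1 : ∀ᶠ T in atTop, S.normalShiftTail α τ Tlo r₁ T < 1 :=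
    (h.tendsto hr).eventually (gt_mem_nhds (by norm_num))
  exact h1.mono fun T hT ↦ hT.trans ENNReal.one_lt_top

end ADMTailTuple

end Literature.Geometry.Lorentzian

end
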